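import Summits.HubbardSuperconductivity.HubbardSuperconductivity.Theses.AnisotropyChord
import Summits.HubbardSuperconductivity.HubbardSuperconductivity.Theorems.AnisotropyChordThermalChordOfConcave

/-!
# Crux `ChordXY` (stmt-HubbardSuperconductivity-8146) — line `condensate-slab`
# (crux-plan, 2026-08-31): CONCAVITY IN THE ANISOTROPY OF THE IMAGINARY-TIME SLAB CONDENSATE AT EVERY
# INVERSE TEMPERATURE ⇒ the route item `ChordXY` by name

Notation: `H_M(Δ) = xxzHamiltonian 1 (torusGraph 2 M) (-1) Δ = -Σ_{xy} (SˣSˣ + SʸSʸ + Δ SᶻSᶻ)` on the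
`M × M` torus, `P₀ = sectorProj M` (projection onto `S^z_tot = 0`), `A = condensateOp M = S⁺_tot S⁻_tot`,
`𝟙` the all-ones vector of the `Sᶻ`-configuration basis (so `P₀ 𝟙` = the uniform superposition of the
half-filled configurations = `|S = M²/2, Sᶻ = 0⟩`, the sector component of the fully `x`-polarised state).

The SLAB VECTOR `v_β(Δ) = e^{-β H_M(Δ)} P₀ 𝟙` and the SLAB CONDENSATE (a Rayleigh quotient, NOT a trace)
`Λˢ_{β,M}(Δ) = Re ⟨v_β, A v_β⟩ / ⟨v_β, v_β⟩` — the condensate measured in the middle of an imaginary-time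
slab of thickness `2β` with the symmetry-breaking boundary state `P₀𝟙` at both ends. `Λˢ_{0,M} ≡ S(S+1)`,
`S = M²/2` (constant in `Δ`), and `Λˢ_{β,M}(Δ) → Λ(ψ_Δ) = Re⟨ψ_Δ, A ψ_Δ⟩` (the ground-state condensate of
the crux) as `β → ∞`, because `⟨ψ_Δ, P₀𝟙⟩ > 0` for the Perron ground state.

Stubs (registered):
* `stub_slabConcave_smallBeta` [rung, size M–L] — for every even `M ≥ 4` there is `β₀(M) > 0` with
  `Δ ↦ Λˢ_{β,M}(Δ)` concave on `[-1,0]` for `0 < β ≤ β₀` (second-order expansion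
  `Λˢ = S(S+1) − β²(1−Δ)² κ_M + O_M(β³)`, `κ_M > 0`; GRAPH-BLIND — carries no `d = 2` information, it is the
  base of the continuation and the witness that the functional is concave for a structural reason).
* `stub_slabConcavity_propagates` [HARDEST, XL, research] — concavity on a base interval `(0, β₀]`
  propagates to EVERY `β > 0` (even `M ≥ 4`, the `M × M` torus). This is where `d = 2` must enter: on the
  ring `C₁₆` the slab condensate turns CONVEX near `Δ = 0⁻` from `β ≈ 0.75` on (seat-1 numerics), so no
  graph-blind argument can prove it. A typed sufficient condition is proved below
  (`slabConcavity_propagates_of_increments`: concave `β`-increments).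
* `stub_slabGroundStateLimit` [size M] — `Λˢ_{β,M}(Δ) → Re⟨ψ, Aψ⟩` for every normalised sector ground state
  `ψ` of `H_M(Δ)` (sectorwise power method `groundProjection_of_groundOverlap` + Perron–Frobenius
  `xxz_sector_perron_pos` / `xxzTorus_sectorGroundSpace_unique`).
PROVED here: `slabCondensate_nonneg`, `slabConcavity_propagates_of_increments`, the composition
`chordXY_of_slab` and `ChordXY_of : ChordXY` (sorries ONLY in `stub_*`).

Why this is not line `concavity_af` (GS concavity) in costume: the stubs quantify over EVERY finite `β`
(a statement false on rings and ladders-in-β-monotone form, true on all 735 tested torus points), and the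
finite-`β` object `v_β` is a positive vector of the stoquastic cone with an explicit boundary, amenable to
path-space / log-concavity tools that the ground state alone does not expose. Why not line `thermal_af`:
the periodic trace `tr(P₀e^{-βH}A)/tr(P₀e^{-βH})` at fixed `β` and `M → ∞` is a KT/high-temperature
quantity (`≈ χ·M²`, convex in `Δ` near `0⁻` at large `M`), the slab is not (boundary LRO at every `β`).
HONEST: nothing here proves `ChordXY`, 8146, or any summit statement; superconductivity in the Hubbard
model is NOT advanced by this file.
Disproof used: none exists for this crux (no `Cruxes/ChordXY/Disproof.lean`). Dead lines avoided:
`loop-russo` (costume, no inequality) — not used; `∀ᶠ β` typing (TRIAGE-r1-1 (i), TRIAGE-r1-2 §2.3(a)) —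
replaced by `∀ β > 0`.
-/

set_option linter.dupNamespace false

noncomputable section

open scoped ComplexOrder

namespace Summit.HubbardSuperconductivity.HubbardSuperconductivity.Cruxes.ChordXY.CondensateSlab

open Matrix Filter Topology
open Literature.MathematicalPhysics.QuantumLattice Literature.Probability.LatticeModels
open Summit.HubbardSuperconductivity.HubbardSuperconductivity.Theses.AnisotropyChord
open Summit.HubbardSuperconductivity.HubbardSuperconductivity.Theorems.AnisotropyChord

/-- The SLAB VECTOR `v_β(Δ) = e^{-β H_M(Δ)} P₀ 𝟙`: imaginary-time evolution, for time `β`, of the sector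
component of the fully `x`-polarised state. [statement abbreviation] -/
def slabVec (M : ℕ) [NeZero M] (β Δ : ℝ) : TensorIndex (TorusSite 2 M) 2 → ℂ :=
  gibbsWeight β (xxzHamiltonian 1 (torusGraph 2 M) (-1) Δ) *ᵥ (sectorProj M *ᵥ fun _ => 1)

/-- The SLAB CONDENSATE `Λˢ_{β,M}(Δ) = Re(⟨v_β, S⁺_tot S⁻_tot v_β⟩ / ⟨v_β, v_β⟩)` (junk value `0` if
`v_β = 0`, which does not happen for even `M ≥ 2`). [statement abbreviation] -/
def slabCondensate (M : ℕ) [NeZero M] (β Δ : ℝ) : ℝ :=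
  ((star (slabVec M β Δ) ⬝ᵥ (condensateOp M *ᵥ slabVec M β Δ)) /
    (star (slabVec M β Δ) ⬝ᵥ slabVec M β Δ)).re

/-- STUB 1 (rung, graph-blind) — SMALL-`β` CONCAVITY: for every even `M ≥ 4` there is `β₀ > 0` such that
`Δ ↦ Λˢ_{β,M}(Δ)` is concave on `[-1,0]` for all `β ∈ (0, β₀]`. Mechanism: `P₀𝟙` is the top eigenvector of
`A` on the sector (eigenvalue `S(S+1)`, simple) and an eigenvector of the isotropic part `-Σ 𝐒_x·𝐒_y` of
`H_M(Δ) = -Σ 𝐒_x·𝐒_y + (1-Δ) Σ SᶻSᶻ`, so `Λˢ_{β,M}(Δ) = S(S+1) - β²(1-Δ)²κ_M + O_M(β³)` uniformly on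
`[-1,0]` with `κ_M = ⟨(D P₀𝟙)^⊥, (S(S+1) - A)(D P₀𝟙)^⊥⟩/‖P₀𝟙‖² > 0`, `D = Σ SᶻSᶻ`; hence
`∂²_Δ Λˢ = -2β²κ_M + O_M(β³) < 0` for small `β`. [folklore perturbation theory; Kato, *Perturbation Theory
for Linear Operators*, II §2] -/
theorem stub_slabConcave_smallBeta :
    ∀ (M : ℕ) [NeZero M], Even M → 4 ≤ M → ∃ β₀ : ℝ, 0 < β₀ ∧ ∀ β ∈ Set.Ioc (0:ℝ) β₀,
      ConcaveOn ℝ (Set.Icc (-1:ℝ) 0) (fun Δ : ℝ => slabCondensate M β Δ) := by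
  sorry

/-- STUB 2 (HARDEST; the research step, where `d = 2` must enter) — CONCAVITY PROPAGATES IN `β`: on the
even `M × M` torus, `M ≥ 4`, if `Δ ↦ Λˢ_{β,M}(Δ)` is concave on `[-1,0]` for all `β` in some base interval
`(0, β₀]`, then it is concave on `[-1,0]` for EVERY `β > 0`. False for the ring `C₁₆` in place of the torus
(convex near `Δ = 0⁻` from `β ≈ 0.75`; seat-1 NUMERICS), observed at all 630 tested `(Δ, β)` points of the
tori `4×4`, `√18×√18`, `√20×√20`. Candidate tools (none yet adequate — IDEA-NEEDED): concavity of the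
`β`-increments (`slabConcavity_propagates_of_increments` below; observed on the three tori, fails on the
`2×8` ladder), a maximum principle for `u = ∂²_Δ Λˢ` along the flow `∂_β v = -H v`, log-concavity of the
two-boundary loop measure in the Ising coupling `g = 1-Δ ∈ [1,2]` using the SU(2) point `g = 2`.
[research; Kennedy–Lieb–Shastry, J. Stat. Phys. 53 (1988); Tasaki (2020) §4.1] -/
theorem stub_slabConcavity_propagates :
    ∀ (M : ℕ) [NeZero M], Even M → 4 ≤ M → ∀ β₀ : ℝ, 0 < β₀ →
      (∀ β ∈ Set.Ioc (0:ℝ) β₀, ConcaveOn ℝ (Set.Icc (-1:ℝ) 0) (fun Δ : ℝ => slabCondensate M β Δ)) →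
      ∀ β : ℝ, 0 < β → ConcaveOn ℝ (Set.Icc (-1:ℝ) 0) (fun Δ : ℝ => slabCondensate M β Δ) := by
  sorry

/-- STUB 3 — GROUND-STATE LIMIT OF THE SLAB: for even `M ≥ 2`, every real `Δ` and every normalised
`S^z_tot = 0` ground state `ψ` of `H_M(Δ)`, `Λˢ_{β,M}(Δ) → Re⟨ψ, S⁺_tot S⁻_tot ψ⟩` as `β → ∞`. Proof plan:
`groundProjection_of_groundOverlap` with `K` = the sector, `v = P₀𝟙`, `w₀ = ψ`; the overlap `⟨ψ, P₀𝟙⟩ ≠ 0`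
because the sector ground state is a multiple of the entrywise-positive Perron vector
(`xxz_sector_perron_pos`, `xxzTorus_sectorGroundSpace_unique`); the Rayleigh quotient is invariant under
the rescaling `e^{βE}` and continuous at the non-zero limit vector. [folklore; Bratteli–Robinson II §5.3.1;
Tasaki (2020) §2.2, §4.1] -/
theorem stub_slabGroundStateLimit :
    ∀ (M : ℕ) [NeZero M], Even M → 2 ≤ M → ∀ (Δ : ℝ) (ψ : TensorIndex (TorusSite 2 M) 2 → ℂ),
      ψ ∈ spinZSector (Λ := TorusSite 2 M) 1 0 → star ψ ⬝ᵥ ψ = 1 →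
      Matrix.mulVec (xxzHamiltonian 1 (torusGraph 2 M) (-1) Δ) ψ =
        ((lowestEnergyInSector 1 (xxzHamiltonian 1 (torusGraph 2 M) (-1) Δ) 0 : ℝ) : ℂ) • ψ →
      Tendsto (fun β : ℝ => slabCondensate M β Δ) atTop
        (𝓝 ((star ψ ⬝ᵥ Matrix.mulVec ((∑ x : TorusSite 2 M, onSite x (spinRaise 1)) *
          (∑ y : TorusSite 2 M, onSite y (spinLower 1))) ψ).re)) := by
  sorry

/-- **The slab condensate is nonnegative**: `Λˢ_{β,M}(Δ) ≥ 0` for every `M`, `β`, `Δ` (numerator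
`⟨v, S⁺S⁻ v⟩ ≥ 0` since `S⁺_tot S⁻_tot = B Bᴴ`, denominator `⟨v, v⟩ ≥ 0` real; junk value `x/0 = 0`
covers `v = 0`). [folklore] -/
theorem slabCondensate_nonneg (M : ℕ) [NeZero M] (β Δ : ℝ) : 0 ≤ slabCondensate M β Δ := by
  unfold slabCondensate
  obtain ⟨hn_re, hn_im⟩ := Complex.nonneg_iff.mp
    ((condensateOp_posSemidef M).dotProduct_mulVec_nonneg (slabVec M β Δ))
  obtain ⟨hd_re, hd_im⟩ := Complex.nonneg_iff.mp (dotProduct_star_self_nonneg (slabVec M β Δ))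
  rw [Complex.div_re, ← hn_im, zero_mul, zero_div, add_zero]
  exact div_nonneg (mul_nonneg hn_re hd_re) (Complex.normSq_nonneg _)

/-- **Typed sufficient condition for STUB 2 (Entrance B, "concave increments")**: if for all
`0 < β ≤ β'` the increment `Δ ↦ Λˢ_{β',M}(Δ) - Λˢ_{β,M}(Δ)` is concave on `[-1,0]`, then concavity on a base
interval `(0, β₀]` propagates to every `β > 0` (`Λˢ_{β'} = Λˢ_{β} + increment`, `ConcaveOn.add`).
Equivalent, for smooth `Λˢ`, to `β ↦ ∂²_Δ Λˢ_{β,M}(Δ)` antitone — observed on the tori `4×4`, `√18`, `√20`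
(seat-1 exact NUMERICS), but FALSE on the `2×8` ladder and DISFAVOURED at large `M` by the linear-spin-wave
slab (F-slab-0, this line's falsifier file: the concavity margin at `Δ = 0⁻` dips below its `β = ∞` value
around `β ≈ L/6` and recovers). Recorded as the typed form of the "defect antitone" instrument reading, NOT a
registered stub and not the recommended bet. [bookkeeping] -/
theorem slabConcavity_propagates_of_increments (M : ℕ) [NeZero M]
    (hinc : ∀ β β' : ℝ, 0 < β → β ≤ β' →
      ConcaveOn ℝ (Set.Icc (-1:ℝ) 0) (fun Δ : ℝ => slabCondensate M β' Δ - slabCondensate M β Δ))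
    (β₀ : ℝ) (hβ₀ : 0 < β₀)
    (hbase : ∀ β ∈ Set.Ioc (0:ℝ) β₀, ConcaveOn ℝ (Set.Icc (-1:ℝ) 0) (fun Δ : ℝ => slabCondensate M β Δ)) :
    ∀ β : ℝ, 0 < β → ConcaveOn ℝ (Set.Icc (-1:ℝ) 0) (fun Δ : ℝ => slabCondensate M β Δ) := by
  intro β hβ
  by_cases hle : β ≤ β₀
  · exact hbase β ⟨hβ, hle⟩
  · have h := (hbase β₀ ⟨hβ₀, le_rfl⟩).add (hinc β₀ β hβ₀ (not_le.mp hle).le)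
    refine h.congr ?_
    intro Δ _
    simp only [Pi.add_apply]
    ring

/-- COMPOSITION — the three stubs give the route item `ChordXY` (stmt-8146) BY NAME: for every `β > 0`
the slab condensate is concave on `[-1,0]` (stubs 1 + 2) and nonnegative at `-1`, hence above its chord,
`(1+Δ)·Λˢ_{β,M}(0) ≤ Λˢ_{β,M}(Δ)` (`chord_of_concaveOn_of_nonneg`); both sides converge as `β → ∞` to
`(1+Δ)·Λ(ψ₀)` and `Λ(ψ)` (stub 3 at `Δ = 0` and at `Δ`), and `≤` passes to the limit. [folklore] -/
theorem chordXY_of_slab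
    (h1 : ∀ (M : ℕ) [NeZero M], Even M → 4 ≤ M → ∃ β₀ : ℝ, 0 < β₀ ∧ ∀ β ∈ Set.Ioc (0:ℝ) β₀,
      ConcaveOn ℝ (Set.Icc (-1:ℝ) 0) (fun Δ : ℝ => slabCondensate M β Δ))
    (h2 : ∀ (M : ℕ) [NeZero M], Even M → 4 ≤ M → ∀ β₀ : ℝ, 0 < β₀ →
      (∀ β ∈ Set.Ioc (0:ℝ) β₀, ConcaveOn ℝ (Set.Icc (-1:ℝ) 0) (fun Δ : ℝ => slabCondensate M β Δ)) →
      ∀ β : ℝ, 0 < β → ConcaveOn ℝ (Set.Icc (-1:ℝ) 0) (fun Δ : ℝ => slabCondensate M β Δ))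
    (h3 : ∀ (M : ℕ) [NeZero M], Even M → 2 ≤ M → ∀ (Δ : ℝ) (ψ : TensorIndex (TorusSite 2 M) 2 → ℂ),
      ψ ∈ spinZSector (Λ := TorusSite 2 M) 1 0 → star ψ ⬝ᵥ ψ = 1 →
      Matrix.mulVec (xxzHamiltonian 1 (torusGraph 2 M) (-1) Δ) ψ =
        ((lowestEnergyInSector 1 (xxzHamiltonian 1 (torusGraph 2 M) (-1) Δ) 0 : ℝ) : ℂ) • ψ →
      Tendsto (fun β : ℝ => slabCondensate M β Δ) atTop
        (𝓝 ((star ψ ⬝ᵥ Matrix.mulVec ((∑ x : TorusSite 2 M, onSite x (spinRaise 1)) *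
          (∑ y : TorusSite 2 M, onSite y (spinLower 1))) ψ).re))) :
    ChordXY := by
  intro M _ hE h4 Δ hΔ ψ₀ ψ hmem₀ hψ₀1 heig₀ hmem hψ1 heig
  have h2M : 2 ≤ M := le_trans (by norm_num) h4
  obtain ⟨β₀, hβ₀, hbase⟩ := h1 M hE h4
  have hall : ∀ β : ℝ, 0 < β → ConcaveOn ℝ (Set.Icc (-1:ℝ) 0) (fun Δ : ℝ => slabCondensate M β Δ) :=
    h2 M hE h4 β₀ hβ₀ hbase
  have hchord : ∀ᶠ β : ℝ in atTop, (1 + Δ) * slabCondensate M β 0 ≤ slabCondensate M β Δ :=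
    (eventually_gt_atTop (0:ℝ)).mono fun β hβ =>
      chord_of_concaveOn_of_nonneg (hall β hβ) (slabCondensate_nonneg M β (-1)) hΔ
  have hlim₀ := (h3 M hE h2M 0 ψ₀ hmem₀ hψ₀1 heig₀).const_mul (1 + Δ)
  have hlim := h3 M hE h2M Δ ψ hmem hψ1 heig
  exact le_of_tendsto_of_tendsto hlim₀ hlim hchord

/-- Entrance B composed to the crux: small-`β` concavity + concave `β`-increments + the ground-state limit
give `ChordXY` (via `slabConcavity_propagates_of_increments` and `chordXY_of_slab`). [bookkeeping] -/
theorem chordXY_of_slabIncrements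
    (h1 : ∀ (M : ℕ) [NeZero M], Even M → 4 ≤ M → ∃ β₀ : ℝ, 0 < β₀ ∧ ∀ β ∈ Set.Ioc (0:ℝ) β₀,
      ConcaveOn ℝ (Set.Icc (-1:ℝ) 0) (fun Δ : ℝ => slabCondensate M β Δ))
    (hinc : ∀ (M : ℕ) [NeZero M], Even M → 4 ≤ M → ∀ β β' : ℝ, 0 < β → β ≤ β' →
      ConcaveOn ℝ (Set.Icc (-1:ℝ) 0) (fun Δ : ℝ => slabCondensate M β' Δ - slabCondensate M β Δ))
    (h3 : ∀ (M : ℕ) [NeZero M], Even M → 2 ≤ M → ∀ (Δ : ℝ) (ψ : TensorIndex (TorusSite 2 M) 2 → ℂ),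
      ψ ∈ spinZSector (Λ := TorusSite 2 M) 1 0 → star ψ ⬝ᵥ ψ = 1 →
      Matrix.mulVec (xxzHamiltonian 1 (torusGraph 2 M) (-1) Δ) ψ =
        ((lowestEnergyInSector 1 (xxzHamiltonian 1 (torusGraph 2 M) (-1) Δ) 0 : ℝ) : ℂ) • ψ →
      Tendsto (fun β : ℝ => slabCondensate M β Δ) atTop
        (𝓝 ((star ψ ⬝ᵥ Matrix.mulVec ((∑ x : TorusSite 2 M, onSite x (spinRaise 1)) *
          (∑ y : TorusSite 2 M, onSite y (spinLower 1))) ψ).re))) :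
    ChordXY :=
  chordXY_of_slab h1
    (fun M _ hE h4 β₀ hβ₀ hbase => slabConcavity_propagates_of_increments M (hinc M hE h4) β₀ hβ₀ hbase) h3

/-- COMPOSITION TO THE CRUX BY NAME — `ChordXY` from the registered stubs (type = the route decl
`Summit.HubbardSuperconductivity.HubbardSuperconductivity.Theses.AnisotropyChord.ChordXY`; sorries live
only in `stub_*`). -/
theorem ChordXY_of : ChordXY :=
  chordXY_of_slab stub_slabConcave_smallBeta stub_slabConcavity_propagates stub_slabGroundStateLimit

end Summit.HubbardSuperconductivity.HubbardSuperconductivity.Cruxes.ChordXY.CondensateSlab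

end
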